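import Literature.Analysis.SpecialFunctions.EllipticPeriodRatioDeriv
import Literature.Analysis.SpecialFunctions.EllipticKAGM
import Literature.Analysis.SpecialFunctions.ThetaAGM
import Literature.NumberTheory.EllipticCurves.JacobiThetaQuartic
import HarnessLib

/-!
# Jacobi's inversion theorem: `K = (π/2)θ₃²`, `k = θ₂²/θ₃²`, `k′ = θ₄²/θ₃²` at the nome `q = e^{−πK′/K}`

Topic `Literature/Analysis/SpecialFunctions`. For a modulus `0 < k < 1` let `K = K(k)`,
`K′ = K(√(1−k²))` (the tree's `completeEllipticK`) and put `σ = K′/K`, `q = e^{−πσ}`, `τ = iσ`.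
Jacobi's inversion theorem (Whittaker–Watson §21.61, §22.301; Borwein–Borwein, *Pi and the AGM*
Thm 2.3; Lawden §2.1–2.2 with (2.2.3) `q = exp(−πK′/K)`) identifies the thetanulls at this nome:

  `K(k) = (π/2) θ₃(q)²`,  `k = θ₂(q)²/θ₃(q)²`,  `√(1−k²) = θ₄(q)²/θ₃(q)²`.

Everything is PROVED here, assembling results already in the tree:

* Gauss's AGM theorem `K(1 − b²/a²) = πa/(2M(a,b))` (`EllipticKAGM.lean`) and the theta AGM
  `M(θ₄(q)², θ₃(q)²) = 1` (`ThetaAGM.lean`, real nome) give `K(κ(σ)) = (π/2)θ₃(iσ)²` for the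
  modulus `κ(σ) := θ₂(iσ)²/θ₃(iσ)²`, whose complementary modulus is `θ₄²/θ₃²` by Jacobi's quartic
  identity (`JacobiThetaQuartic.lean`);
* the `S`-laws `θ₃(i/σ) = σ^{1/2}θ₃(iσ)`, `θ₂(i/σ) = σ^{1/2}θ₄(iσ)`
  (`JacobiThetaDerivativeFormula.lean`, from Mathlib's functional equation of `jacobiTheta₂`) show
  that the dual nome `e^{−π/σ}` has modulus `κ′`, whence `K(κ′(σ)) = σ·K(κ(σ))`: the modulus
  `κ(σ)` has period ratio `K′/K = σ`;
* `k ↦ K′/K` is injective on `(0,1)` (`EllipticPeriodRatioDeriv.lean`), so `κ(K′(k)/K(k)) = k`.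

Main statements: `completeEllipticK_thetaModulus` (`K(κ(σ)) = (π/2)θ₃(iσ)²`),
`completeEllipticK_thetaComodulus` (`K(κ′(σ)) = (π/2)σθ₃(iσ)²`), `periodRatio_thetaModulus`
(`K′/K = σ` at `k = κ(σ)`), and the inversion `thetaModulus_periodRatio`,
`thetaComodulus_periodRatio`, `completeEllipticK_eq_theta3_sq` (`K(k) = (π/2)θ₃(iK′/K)²`),
`completeEllipticK_eq_thetaThree_sq` (the same with the real-nome `thetaThree (e^{−πK′/K})`).
No new definitions (the moduli are written out as `(theta2 (I*σ)).re ^ 2 / (theta3 (I*σ)).re ^ 2`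
etc.); no named facts.

## References

* E. T. Whittaker, G. N. Watson, *A Course of Modern Analysis*, 4th ed. (1927), §21.61, §22.301,
  §22.32.
* J. M. Borwein, P. B. Borwein, *Pi and the AGM*, Wiley (1987), Thm 2.1, Thm 2.3.
* [Lawden1989] D. F. Lawden, *Elliptic Functions and Applications*, Springer (1989), §2.1–2.2,
  eq. (2.2.3).
-/

noncomputable section

open Real Complex _root_.MeasureTheory _root_.Set _root_.Filter NNReal
open scoped _root_.Topology NNReal Real

namespace Literature.Analysis.SpecialFunctions

open Literature.Probability.RandomPlanarGeometry
open Literature.NumberTheory.EllipticCurves.JacobiThetaNull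

/-! ### Real-nome thetas versus the thetanulls on the imaginary axis -/

/-- `θ₃` bridge: the real-nome `thetaThree (e^{−πy})` of `ThetaAGM.lean` is the thetanull
`θ₃(iy)` (which is real). [folklore] -/
theorem thetaThree_exp_neg_eq_re {y : ℝ} (hy : 0 < y) :
    thetaThree (rexp (-(π * y))) = (theta3 (I * y)).re := by
  rw [← gaussLatticeSum_eq_thetaThree (π * y), theta3_I_mul hy, Complex.ofReal_re, gaussLatticeSum]
  refine tsum_congr (fun n => ?_)
  congr 1
  ring

/-- `e^{πin} = (−1)^{n²}` for an integer `n` (as the real sign `(−1)^{|n|²}`). [folklore] -/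
theorem cexp_pi_mul_I_mul_int (n : ℤ) :
    cexp (π * I * n) = (((-1 : ℝ) ^ (n.natAbs ^ 2) : ℝ) : ℂ) := by
  have h : cexp (π * I * n) = (-1 : ℂ) ^ n := by
    rw [show (π * I * n : ℂ) = n * (π * I) by ring, Complex.exp_int_mul, Complex.exp_pi_mul_I]
  rw [h]
  rcases Int.even_or_odd n with hn | hn
  · rw [hn.neg_one_zpow, ((even_natAbs_sq_iff n).mpr hn).neg_one_pow]
    simp
  · have hodd : Odd (n.natAbs ^ 2) := by
      rcases Nat.even_or_odd (n.natAbs ^ 2) with h2 | h2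
      · exact absurd ((even_natAbs_sq_iff n).mp h2) (Int.not_even_iff_odd.mpr hn)
      · exact h2
    rw [hn.neg_one_zpow, hodd.neg_one_pow]
    simp

/-- `θ₄` bridge: `thetaFour (e^{−πy}) = θ₄(iy)` (real part; `θ₄(iy)` is real). [folklore] -/
theorem thetaFour_exp_neg_eq_re {y : ℝ} (hy : 0 < y) :
    thetaFour (rexp (-(π * y))) = (theta4 (I * y)).re := by
  have hτ := im_I_mul_pos hy
  have hsum := hasSum_jacobiTheta₂_term (1 / 2 : ℂ) hτ
  have hn : ∀ n : ℤ, ((n.natAbs ^ 2 : ℕ) : ℝ) = (n : ℝ) ^ 2 := by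
    intro n
    push_cast
    rw [Nat.cast_natAbs, Int.cast_abs, sq_abs]
  have e : ∀ n : ℤ, jacobiTheta₂_term n (1 / 2 : ℂ) (I * y) =
      ((((-1 : ℝ) ^ (n.natAbs ^ 2) * rexp (-(π * y) * (n : ℝ) ^ 2) : ℝ)) : ℂ) := by
    intro n
    rw [jacobiTheta₂_term, show (2 * π * I * n * (1 / 2) + π * I * n ^ 2 * (I * y) : ℂ) =
      π * I * n + ((-(π * y) * (n : ℝ) ^ 2 : ℝ) : ℂ) by push_cast; linear_combination (π * y * n ^ 2 : ℂ) * I_mul_I,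
      Complex.exp_add, cexp_pi_mul_I_mul_int]
    push_cast
    ring_nf
  have e' : ∀ n : ℤ, (-rexp (-(π * y))) ^ (n.natAbs ^ 2) =
      (-1 : ℝ) ^ (n.natAbs ^ 2) * rexp (-(π * y) * (n : ℝ) ^ 2) := by
    intro n
    rw [neg_pow, ← hn n, mul_comm (-(π * y)) _, Real.exp_nat_mul]
  have h4 : theta4 (I * y) = ∑' n : ℤ, jacobiTheta₂_term n (1 / 2 : ℂ) (I * y) := by
    rw [hsum.tsum_eq]; rfl
  rw [h4, tsum_congr e, ← Complex.ofReal_tsum, Complex.ofReal_re, thetaFour, thetaThree]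
  exact tsum_congr (fun n => e' n)

/-- `S`-law on the axis for `θ₃`: `θ₃(i/y) = y^{1/2} θ₃(iy)`. [folklore] -/
theorem theta3_I_mul_inv_re {y : ℝ} (hy : 0 < y) :
    (theta3 (I * (y⁻¹ : ℝ))).re = y ^ (1 / 2 : ℝ) * (theta3 (I * y)).re := by
  have h := theta3_neg_one_div (im_I_mul_pos hy)
  rw [neg_one_div_I_mul hy, cpow_half_I_mul hy] at h
  rw [h, Complex.re_ofReal_mul]

/-- `S`-law on the axis for `θ₂`: `θ₂(i/y) = y^{1/2} θ₄(iy)`. [folklore] -/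
theorem theta2_I_mul_inv_re {y : ℝ} (hy : 0 < y) :
    (theta2 (I * (y⁻¹ : ℝ))).re = y ^ (1 / 2 : ℝ) * (theta4 (I * y)).re := by
  have h := theta2_neg_one_div (im_I_mul_pos hy)
  rw [neg_one_div_I_mul hy, cpow_half_I_mul hy] at h
  rw [h, Complex.re_ofReal_mul]

/-! ### The theta moduli `κ(σ) = θ₂²/θ₃²`, `κ′(σ) = θ₄²/θ₃²` -/

/-- `κ(σ)² + κ′(σ)² = 1` (Jacobi's quartic identity on the axis). [cite: Lawden1989, §1.6] -/
theorem thetaModulus_sq_add_sq {y : ℝ} (hy : 0 < y) :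
    ((theta2 (I * y)).re ^ 2 / (theta3 (I * y)).re ^ 2) ^ 2 +
      ((theta4 (I * y)).re ^ 2 / (theta3 (I * y)).re ^ 2) ^ 2 = 1 := by
  have h3 := pow_pos (theta3_I_mul_re_pos hy) 4
  have hq := theta3_I_mul_re_pow_four hy
  rw [div_pow, div_pow, ← pow_mul, ← pow_mul, ← pow_mul, ← add_div, div_eq_one_iff_eq h3.ne']
  norm_num
  linarith [hq]

/-- `0 < κ(σ) < 1`. [folklore] -/
theorem thetaModulus_mem_Ioo {y : ℝ} (hy : 0 < y) :
    (theta2 (I * y)).re ^ 2 / (theta3 (I * y)).re ^ 2 ∈ Ioo (0 : ℝ) 1 := by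
  have h := theta2_div_theta3_pow_four_mem_Ioo hy
  have hpos : 0 < (theta2 (I * y)).re ^ 2 / (theta3 (I * y)).re ^ 2 :=
    div_pos (pow_pos (theta2_I_mul_re_pos hy) 2) (pow_pos (theta3_I_mul_re_pos hy) 2)
  refine ⟨hpos, ?_⟩
  have hsq : ((theta2 (I * y)).re ^ 2 / (theta3 (I * y)).re ^ 2) ^ 2 < 1 := by
    rw [div_pow, ← pow_mul, ← pow_mul]
    exact h.2
  nlinarith [hsq, hpos]

/-- `0 < κ′(σ)`. [folklore] -/
theorem thetaComodulus_pos {y : ℝ} (hy : 0 < y) :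
    0 < (theta4 (I * y)).re ^ 2 / (theta3 (I * y)).re ^ 2 :=
  div_pos (pow_pos (theta4_I_mul_re_pos hy) 2) (pow_pos (theta3_I_mul_re_pos hy) 2)

/-- `κ′(σ) = √(1 − κ(σ)²)`. [folklore] -/
theorem thetaComodulus_eq_sqrt {y : ℝ} (hy : 0 < y) :
    (theta4 (I * y)).re ^ 2 / (theta3 (I * y)).re ^ 2 =
      Real.sqrt (1 - ((theta2 (I * y)).re ^ 2 / (theta3 (I * y)).re ^ 2) ^ 2) := by
  have h := thetaModulus_sq_add_sq hy
  rw [show 1 - ((theta2 (I * y)).re ^ 2 / (theta3 (I * y)).re ^ 2) ^ 2 =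
      ((theta4 (I * y)).re ^ 2 / (theta3 (I * y)).re ^ 2) ^ 2 by linarith,
    Real.sqrt_sq (thetaComodulus_pos hy).le]

/-- `κ(σ) = √(1 − κ′(σ)²)`. [folklore] -/
theorem thetaModulus_eq_sqrt {y : ℝ} (hy : 0 < y) :
    (theta2 (I * y)).re ^ 2 / (theta3 (I * y)).re ^ 2 =
      Real.sqrt (1 - ((theta4 (I * y)).re ^ 2 / (theta3 (I * y)).re ^ 2) ^ 2) := by
  have h := thetaModulus_sq_add_sq hy
  rw [show 1 - ((theta4 (I * y)).re ^ 2 / (theta3 (I * y)).re ^ 2) ^ 2 =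
      ((theta2 (I * y)).re ^ 2 / (theta3 (I * y)).re ^ 2) ^ 2 by linarith,
    Real.sqrt_sq (thetaModulus_mem_Ioo hy).1.le]

/-- Duality of the moduli under `σ ↦ 1/σ`: `κ(1/σ) = κ′(σ)`. [folklore] -/
theorem thetaModulus_inv {y : ℝ} (hy : 0 < y) :
    (theta2 (I * (y⁻¹ : ℝ))).re ^ 2 / (theta3 (I * (y⁻¹ : ℝ))).re ^ 2 =
      (theta4 (I * y)).re ^ 2 / (theta3 (I * y)).re ^ 2 := by
  rw [theta2_I_mul_inv_re hy, theta3_I_mul_inv_re hy, mul_pow, mul_pow]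
  have hy' : 0 < (y ^ (1 / 2 : ℝ)) ^ 2 := pow_pos (Real.rpow_pos_of_pos hy _) 2
  have h3 : 0 < (theta3 (I * y)).re ^ 2 := pow_pos (theta3_I_mul_re_pos hy) 2
  field_simp

/-! ### `K` at the theta moduli -/

/-- **`K(κ(σ)) = (π/2)θ₃(iσ)²`**: Gauss's AGM formula `K(1 − b²/a²) = πa/(2M(a,b))` at
`a = θ₃², b = θ₄²`, where `M(θ₄², θ₃²) = 1`. [cite: Lawden1989, §2.2 (K = ½πθ₃²)] -/
theorem completeEllipticK_thetaModulus {y : ℝ} (hy : 0 < y) :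
    completeEllipticK ((theta2 (I * y)).re ^ 2 / (theta3 (I * y)).re ^ 2) =
      π / 2 * (theta3 (I * y)).re ^ 2 := by
  have h3 := theta3_I_mul_re_pos hy
  have h4 := theta4_I_mul_re_pos hy
  have ha : 0 < (theta3 (I * y)).re ^ 2 := pow_pos h3 2
  have hb : 0 < (theta4 (I * y)).re ^ 2 := pow_pos h4 2
  -- the AGM of `(θ₃², θ₄²)` is `1`
  set q : ℝ := rexp (-(π * y)) with hq
  have hq0 : 0 ≤ q := (Real.exp_pos _).le
  have hq1 : q < 1 := Real.exp_lt_one_iff.mpr (by have := Real.pi_pos; nlinarith)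
  have hagm : (((theta3 (I * y)).re ^ 2).toNNReal).agm ((theta4 (I * y)).re ^ 2).toNNReal = 1 := by
    have e3 : ((theta3 (I * y)).re ^ 2).toNNReal = thetaThreeSq q := by
      rw [← thetaThree_exp_neg_eq_re hy, ← coe_thetaThreeSq, Real.toNNReal_coe]
    have e4 : ((theta4 (I * y)).re ^ 2).toNNReal = thetaFourSq q := by
      rw [← thetaFour_exp_neg_eq_re hy, ← coe_thetaFourSq, Real.toNNReal_coe]
    rw [e3, e4, NNReal.agm_comm, agm_thetaFourSq_thetaThreeSq hq0 hq1]
  have hK := ellipticK_eq_pi_mul_div_agm ha hb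
  rw [hagm, NNReal.coe_one, mul_one] at hK
  rw [completeEllipticK_eq_ellipticK]
  have hm : ((theta2 (I * y)).re ^ 2 / (theta3 (I * y)).re ^ 2) ^ 2 =
      1 - ((theta4 (I * y)).re ^ 2) ^ 2 / ((theta3 (I * y)).re ^ 2) ^ 2 := by
    have h := thetaModulus_sq_add_sq hy
    have h' : ((theta4 (I * y)).re ^ 2) ^ 2 / ((theta3 (I * y)).re ^ 2) ^ 2 =
        ((theta4 (I * y)).re ^ 2 / (theta3 (I * y)).re ^ 2) ^ 2 := by rw [div_pow]
    linarith
  rw [hm, hK]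
  ring

/-- **`K(κ′(σ)) = (π/2)σθ₃(iσ)²`**: the previous formula at the dual nome `e^{−π/σ}`, whose
modulus is `κ′(σ)` by the `S`-laws. [cite: Lawden1989, §2.2 and eq. (2.2.3)] -/
theorem completeEllipticK_thetaComodulus {y : ℝ} (hy : 0 < y) :
    completeEllipticK ((theta4 (I * y)).re ^ 2 / (theta3 (I * y)).re ^ 2) =
      π / 2 * y * (theta3 (I * y)).re ^ 2 := by
  rw [← thetaModulus_inv hy, completeEllipticK_thetaModulus (inv_pos.mpr hy), theta3_I_mul_inv_re hy,
    mul_pow, ← Real.rpow_natCast, ← Real.rpow_mul hy.le]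
  norm_num
  ring

/-- **The period ratio of the theta modulus is `σ`**: `K(√(1 − κ(σ)²))/K(κ(σ)) = σ`.
[cite: Lawden1989, eq. (2.2.3)] -/
theorem periodRatio_thetaModulus {y : ℝ} (hy : 0 < y) :
    completeEllipticK (Real.sqrt (1 - ((theta2 (I * y)).re ^ 2 / (theta3 (I * y)).re ^ 2) ^ 2)) /
        completeEllipticK ((theta2 (I * y)).re ^ 2 / (theta3 (I * y)).re ^ 2) = y := by
  rw [← thetaComodulus_eq_sqrt hy, completeEllipticK_thetaComodulus hy,
    completeEllipticK_thetaModulus hy]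
  have h3 : 0 < (theta3 (I * y)).re ^ 2 := pow_pos (theta3_I_mul_re_pos hy) 2
  have hπ := Real.pi_pos
  rw [div_eq_iff (by positivity)]
  ring

/-! ### Inversion: the nome of a modulus -/

/-- **Jacobi's inversion, modulus**: for `0 < k < 1` and `σ = K′(k)/K(k)`,
`θ₂(iσ)²/θ₃(iσ)² = k`. [cite: Lawden1989, §2.1–2.2, eq. (2.2.3)] -/
theorem thetaModulus_periodRatio {k : ℝ} (hk : k ∈ Ioo (0 : ℝ) 1) :
    (theta2 (I * ↑(completeEllipticK (Real.sqrt (1 - k ^ 2)) / completeEllipticK k))).re ^ 2 /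
        (theta3 (I * ↑(completeEllipticK (Real.sqrt (1 - k ^ 2)) / completeEllipticK k))).re ^ 2 = k := by
  set y : ℝ := completeEllipticK (Real.sqrt (1 - k ^ 2)) / completeEllipticK k with hy
  have hypos : 0 < y := by
    have h : y ∈ Ioi (0 : ℝ) := by
      rw [← image_completeEllipticK_ratio]
      exact ⟨k, hk, rfl⟩
    exact h
  have hκ := thetaModulus_mem_Ioo hypos
  have hratio := periodRatio_thetaModulus hypos
  -- both `κ(y)` and `k` have period ratio `y`; the ratio is injective on `(0,1)`
  exact strictAntiOn_completeEllipticK_ratio.injOn hκ hk (hratio.trans hy)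

/-- **Jacobi's inversion, complementary modulus**: for `0 < k < 1` and `σ = K′(k)/K(k)`,
`θ₄(iσ)²/θ₃(iσ)² = √(1 − k²)`. [cite: Lawden1989, §2.1–2.2, eq. (2.2.3)] -/
theorem thetaComodulus_periodRatio {k : ℝ} (hk : k ∈ Ioo (0 : ℝ) 1) :
    (theta4 (I * ↑(completeEllipticK (Real.sqrt (1 - k ^ 2)) / completeEllipticK k))).re ^ 2 /
        (theta3 (I * ↑(completeEllipticK (Real.sqrt (1 - k ^ 2)) / completeEllipticK k))).re ^ 2 =
      Real.sqrt (1 - k ^ 2) := by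
  have hypos : 0 < completeEllipticK (Real.sqrt (1 - k ^ 2)) / completeEllipticK k := by
    have h : completeEllipticK (Real.sqrt (1 - k ^ 2)) / completeEllipticK k ∈ Ioi (0 : ℝ) := by
      rw [← image_completeEllipticK_ratio]
      exact ⟨k, hk, rfl⟩
    exact h
  rw [thetaComodulus_eq_sqrt hypos, thetaModulus_periodRatio hk]

/-- **Jacobi's inversion theorem `K(k) = (π/2)θ₃(q)²`, `q = e^{−πK′/K}`** (thetanull form:
`θ₃` at `τ = iK′/K`), for `0 < k < 1`. [cite: Lawden1989, §2.2 and eq. (2.2.3)] -/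
theorem completeEllipticK_eq_theta3_sq {k : ℝ} (hk : k ∈ Ioo (0 : ℝ) 1) :
    completeEllipticK k =
      π / 2 * (theta3 (I * ↑(completeEllipticK (Real.sqrt (1 - k ^ 2)) / completeEllipticK k))).re ^ 2 := by
  have hypos : 0 < completeEllipticK (Real.sqrt (1 - k ^ 2)) / completeEllipticK k := by
    have h : completeEllipticK (Real.sqrt (1 - k ^ 2)) / completeEllipticK k ∈ Ioi (0 : ℝ) := by
      rw [← image_completeEllipticK_ratio]
      exact ⟨k, hk, rfl⟩
    exact h
  conv_lhs => rw [← thetaModulus_periodRatio hk]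
  exact completeEllipticK_thetaModulus hypos

/-- **Jacobi's inversion theorem, real-nome form**: `K(k) = (π/2)·thetaThree(e^{−πK′/K})²` with the
real-nome theta `thetaThree q = ∑ q^{n²}` of `ThetaAGM.lean`, for `0 < k < 1`.
[cite: Lawden1989, §2.2 and eq. (2.2.3)] -/
theorem completeEllipticK_eq_thetaThree_sq {k : ℝ} (hk : k ∈ Ioo (0 : ℝ) 1) :
    completeEllipticK k =
      π / 2 * thetaThree (rexp (-(π * (completeEllipticK (Real.sqrt (1 - k ^ 2)) / completeEllipticK k)))) ^ 2 := by
  have hypos : 0 < completeEllipticK (Real.sqrt (1 - k ^ 2)) / completeEllipticK k := by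
    have h : completeEllipticK (Real.sqrt (1 - k ^ 2)) / completeEllipticK k ∈ Ioi (0 : ℝ) := by
      rw [← image_completeEllipticK_ratio]
      exact ⟨k, hk, rfl⟩
    exact h
  rw [thetaThree_exp_neg_eq_re hypos]
  exact completeEllipticK_eq_theta3_sq hk

end Literature.Analysis.SpecialFunctions

end
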